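import Literature.InformationTheory.QuantumCodes.OptimalRadius
import Summits.Ventures.QEC.Census.TwoBGA.TB_g2_2_14_A0_0_0_0_0_1_0_1_5_B0_0_0_0_0_2_1_0_3
import HarnessLib

/-!
# Q4 theorem column — optimal correction radius of certificate-kernel census rows (mixed families (BB A.1 / GB / 2BGA / HB / LP), on-call batch, part 11; 1 rows)

LADDER-QEC (venture cell `qec`), PARTITION row 08 (decoders / correction radius), rung Q4. Each row below is a census code whose
exact parameters are a KERNEL theorem on its distance certificate's CSS code over `Fin n` — `Summit.Ventures.QEC.Census.<X>.isCode :
(<X>.cert.code <X>.commOK_cert).IsCode n k d` (qec-search-7 / qec-search-10 / qec-type-10 / qec-search-4 emitters; check rows = the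
LITERAL gens lists). This file adds the row's radius-column entry:

  `(<X>.cert.code h).HasOptimalRadius t`, `t = ⌊(d − 1)/2⌋` (Literature/InformationTheory/QuantumCodes/OptimalRadius.lean) — SOME
  Pauli decoder (sector-wise minimum-weight decoding, a specified function of the syndrome) corrects every Pauli error of symplectic
  weight `≤ t` and not every one of weight `≤ t + 1`, and NO Pauli decoder — no function of the syndrome whatsoever, sector-wise or
  not — corrects every Pauli error of weight `≤ t + 1` (Gottesman 1997 §2.3; Nielsen–Chuang §10.5.5 p. 467; Delfosse–Nickerson 2021
  §3 "both of these bounds are tight").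

The statements quantify over the commutation proof `h` fed to `DistCert.code` (proof-irrelevant: one object for all `h`), so no
certificate replay is re-run. Proof of every row = `<X>.isCode.hasOptimalRadius_of_eq rfl`. TIER: CERTIFIED, KERNEL-std — pure
corollaries, no `decide`, axioms ⊆ {propext, Classical.choice, Quot.sound} (the sources use `decide` / `decide +kernel` only).
HONEST FRAMING: CERTIFIED column, method = theorem (generic min-weight decoder + optimality over ALL decoders); explicit decoder
tables / BP+OSD radius certificates are qec-search-6's rows — a different lane; nothing probabilistic. qec-type-08 gen 4,
tools/gen_distcert_radius.py.
-/

namespace Summit.Ventures.QEC.Census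

open Literature.InformationTheory.QuantumCodes

/-- Radius column of census row `2bga-g2.2.14-A0-0-0.0-0-1.0-1-5-B0-0-0.0-0-2.1-0-3` (`[[112, 12, 6]]` KERNEL by `TB_g2_2_14_A0_0_0_0_0_1_0_1_5_B0_0_0_0_0_2_1_0_3.isCode`, Census/TwoBGA/TB_g2_2_14_A0_0_0_0_0_1_0_1_5_B0_0_0_0_0_2_1_0_3.lean; gens `matrix_sha256 = 005a1129ae2e382f…`): OPTIMAL
correction radius `2 = ⌊(6−1)/2⌋` — attained by sector-wise minimum-weight decoding, and no Pauli decoder corrects every Pauli error of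
weight `≤ 3`. (proved) [cite: Gottesman1997, §2.3 (chunk p0014 L3)] -/
theorem TB_g2_2_14_A0_0_0_0_0_1_0_1_5_B0_0_0_0_0_2_1_0_3.hasOptimalRadius (h : commOK TB_g2_2_14_A0_0_0_0_0_1_0_1_5_B0_0_0_0_0_2_1_0_3.cert.n TB_g2_2_14_A0_0_0_0_0_1_0_1_5_B0_0_0_0_0_2_1_0_3.cert.HX TB_g2_2_14_A0_0_0_0_0_1_0_1_5_B0_0_0_0_0_2_1_0_3.cert.HZ = true) :
    (TB_g2_2_14_A0_0_0_0_0_1_0_1_5_B0_0_0_0_0_2_1_0_3.cert.code h).HasOptimalRadius 2 :=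
  TB_g2_2_14_A0_0_0_0_0_1_0_1_5_B0_0_0_0_0_2_1_0_3.isCode.hasOptimalRadius_of_eq rfl

end Summit.Ventures.QEC.Census
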